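import Mathlib

/-!
# PER-LAYER DOMINANCE WITH COMPLEMENT SYMMETRY IS NOT CLOSED UNDER ⊕ U_{2,3} AT THE LEVEL OF THE RANK PROFILE (night-3 g30)

`proofs/NIGHT3-G30-SYMREFUTE.md` §0.  PER-LAYER DOMINANCE (the hypothesis of the landed bridge
`PLDBridge.rls_disjointSum_freeOn_of_pld`, the array form of `PLDClosure.shift10`) is a statement about the multiset of
pairs `(x, f) = (ρ(I), ρ(E ∖ I))`, `I ⊆ E`, i.e. about the rank profile `w(x, f) = #{I : ρ(I) = x, ρ(E ∖ I) = f}`: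
  (PLD)  ∀ lo hi δ Θ, Θ ≤ lo+hi+δ → (lo = 0 ∨ lo+hi+δ ≤ Θ) →
         Σ_I [lo ≤ ρI ≤ hi ∧ Θ ≤ ρ(E∖I)+ρI]·C(ρ(E∖I), δ)  ≤  Σ_I [lo+δ ≤ ρ(E∖I) ≤ hi+δ]·C(ρ(E∖I), δ).
The profile of a matroid is symmetric (`PLDClosure.sum_complement`), and the profile of `M ⊕ U_{2,3}` (a triangle `F`,
`|F| = 3`) is the family of pairs `(ρI + min(|J|, 2), ρ(E∖I) + min(3 − |J|, 2))`, `I ⊆ E`, `J ⊆ F`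
(`PLDClosure.sum_powerset_disjointSum`).  THE SYMMETRIC ARRAY
  `w = {(3,6) ↦ 60, (3,7) ↦ 40, (4,4) ↦ 75, (4,6) ↦ 25, (4,7) ↦ 60, (5,5) ↦ 60, (5,6) ↦ 18, (5,7) ↦ 96, (6,6) ↦ 27}` + mirror
(rank 7, total 760, `x + f ≥ 8` on its support; the Farkas vector of the exact linear programme at rank 7) satisfies
(PLD) at EVERY admissible `(lo, hi, δ, Θ)` (`cex_pld`) — by the reduction of the unbounded binder to the finitely many
canonical instances `lo ≤ hi ≤ 7`, `δ ≤ 7`, `Θ = 0` or `lo+hi+δ` (`pld_of_bounded`, for any family bounded by `R`) and a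
finite computation — while its convolution with the triangle FAILS (PLD) at `(lo, hi, δ, Θ) = (5, 5, 1, 11)`:
`7858 > 7752` (`cex_triangle_fails`).  Hence (`pld_symm_not_closed_triangle`) NO argument that sees only the symmetric
rank profile of `M` — in particular no linear-programming certificate in symmetric coordinates of the kind that exists
through rank 6 — can prove `(PLD)(M) ⇒ (PLD)(M ⊕ U_{2,3})`; the matroid statement itself holds on all 2,198 matroids on
≤ 8 elements and stays open.  Finite computations by `decide`.  No `def`, no `instance`, no notation.  Axioms: standard.
-/

namespace PercRepro

namespace PLDSymCex

open Finset

variable {ι : Type}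

/-- THE REDUCTION TO BOUNDED PARAMETERS: for a family with `x i ≤ R` and `f i ≤ R`, the (PLD) binder follows from its
instances with `lo ≤ hi ≤ R`, `δ ≤ R` and the canonical threshold `Θ = 0` (`lo = 0`) or `Θ = lo + hi + δ`. -/
theorem pld_of_bounded (s : Finset ι) (x f : ι → ℕ) (R : ℕ) (hb : ∀ i ∈ s, x i ≤ R ∧ f i ≤ R)
    (h : ∀ lo hi δ : ℕ, lo ≤ hi → hi ≤ R → δ ≤ R →
      ∑ i ∈ s, (if lo ≤ x i ∧ x i ≤ hi ∧ (if lo = 0 then 0 else lo + hi + δ) ≤ f i + x i then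
          (f i).choose δ else 0) ≤
        ∑ i ∈ s, (if lo + δ ≤ f i ∧ f i ≤ hi + δ then (f i).choose δ else 0)) :
    ∀ lo hi δ Θ : ℕ, Θ ≤ lo + hi + δ → (lo = 0 ∨ lo + hi + δ ≤ Θ) →
      ∑ i ∈ s, (if lo ≤ x i ∧ x i ≤ hi ∧ Θ ≤ f i + x i then (f i).choose δ else 0) ≤
        ∑ i ∈ s, (if lo + δ ≤ f i ∧ f i ≤ hi + δ then (f i).choose δ else 0) := by
  intro lo hi δ Θ _ hlo
  rcases Nat.lt_or_ge R δ with hδ | hδ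
  · -- `δ > R`: every binomial vanishes
    refine le_trans (le_of_eq (Finset.sum_eq_zero fun i him => ?_)) (Nat.zero_le _)
    have := (hb i him).2
    split_ifs
    · exact Nat.choose_eq_zero_of_lt (by omega)
    · rfl
  rcases Nat.lt_or_ge hi lo with hhl | hhl
  · -- empty left window
    refine le_trans (le_of_eq (Finset.sum_eq_zero fun i _ => ?_)) (Nat.zero_le _)
    rw [if_neg (by omega)]
  rcases Nat.lt_or_ge R lo with hRl | hRl
  · -- `lo > R`: the left side is empty
    refine le_trans (le_of_eq (Finset.sum_eq_zero fun i him => ?_)) (Nat.zero_le _)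
    have := (hb i him).1
    rw [if_neg (by omega)]
  -- the canonical instance at `(lo, min hi R, δ)`
  have hmain := h lo (min hi R) δ (le_min hhl hRl) (min_le_right _ _) hδ
  refine le_trans (le_trans (Finset.sum_le_sum fun i him => ?_) hmain) (Finset.sum_le_sum fun i _ => ?_)
  · -- left: the original condition implies the canonical one
    have hx := (hb i him).1
    by_cases hA : lo ≤ x i ∧ x i ≤ hi ∧ Θ ≤ f i + x i
    · rw [if_pos hA, if_pos]
      refine ⟨hA.1, le_min hA.2.1 hx, ?_⟩
      split_ifs with h0
      · exact Nat.zero_le _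
      · rcases hlo with h0' | h1
        · exact absurd h0' h0
        · have : min hi R ≤ hi := min_le_left _ _
          omega
    · rw [if_neg hA]; exact Nat.zero_le _
  · -- right: the window `[lo+δ, min hi R + δ]` sits inside `[lo+δ, hi+δ]`
    have : min hi R ≤ hi := min_le_left _ _
    split_ifs with h1 h2
    · exact le_rfl
    · exact absurd ⟨h1.1, by omega⟩ h2
    · exact Nat.zero_le _
    · exact le_rfl

/-- A WEIGHTED ARRAY AS A FAMILY: the family `{((a, b), k) : a, b < R, k < w a b}` (each pair `(a, b)` with
multiplicity `w a b ≤ W`) sums any `g (x i) (f i)` to the weighted sum `Σ_{a,b<R} w a b · g a b`. -/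
theorem sum_weighted (R W : ℕ) (w : ℕ → ℕ → ℕ) (hw : ∀ a b, w a b ≤ W) (g : ℕ → ℕ → ℕ) :
    ∑ i ∈ ((range R ×ˢ range R) ×ˢ range W).filter (fun p : (ℕ × ℕ) × ℕ => p.2 < w p.1.1 p.1.2),
        g i.1.1 i.1.2 =
      ∑ a ∈ range R, ∑ b ∈ range R, w a b * g a b := by
  rw [Finset.sum_filter, Finset.sum_product, Finset.sum_product]
  refine Finset.sum_congr rfl fun a _ => Finset.sum_congr rfl fun b _ => ?_
  have hfilt : (range W).filter (fun k => k < w a b) = range (w a b) := by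
    ext k
    simp only [mem_filter, mem_range]
    exact ⟨fun h => h.2, fun h => ⟨lt_of_lt_of_le h (hw a b), h⟩⟩
  rw [← Finset.sum_filter, hfilt]
  dsimp only
  rw [Finset.sum_const, Finset.card_range, smul_eq_mul]

/-- THE TRIANGLE CONVOLUTION AS A SUM OVER THE SUBSETS OF A 3-SET: summing `g (x i + min |J| 2) (f i + min (3 − |J|) 2)`
over `i ∈ s` and `J ⊆ F`, `|F| = 3`, groups by `|J| = m` with multiplicity `C(3, m)`. -/
theorem sum_triangle (s : Finset ι) (x f : ι → ℕ) (g : ℕ → ℕ → ℕ) :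
    ∑ j ∈ s ×ˢ (univ : Finset (Finset (Fin 3))),
        g (x j.1 + min (Finset.card j.2) 2) (f j.1 + min (3 - Finset.card j.2) 2) =
      ∑ i ∈ s, ∑ m ∈ range 4, Nat.choose 3 m * g (x i + min m 2) (f i + min (3 - m) 2) := by
  rw [Finset.sum_product]
  refine Finset.sum_congr rfl fun i _ => ?_
  have hpow : (univ : Finset (Finset (Fin 3))) = (univ : Finset (Fin 3)).powerset := by
    rw [Finset.powerset_univ]
  rw [hpow, Finset.sum_powerset_apply_card (fun m => g (x i + min m 2) (f i + min (3 - m) 2))]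
  simp only [Finset.card_univ, Fintype.card_fin, smul_eq_mul]

/-- the witness weights are at most `96` -/
theorem cex_le (a b : ℕ) : (fun x f : ℕ => if (x, f) = (3, 6) ∨ (x, f) = (6, 3) then 60 else
      if (x, f) = (3, 7) ∨ (x, f) = (7, 3) then 40 else if (x, f) = (4, 4) then 75 else
      if (x, f) = (4, 6) ∨ (x, f) = (6, 4) then 25 else if (x, f) = (4, 7) ∨ (x, f) = (7, 4) then 60 else
      if (x, f) = (5, 5) then 60 else if (x, f) = (5, 6) ∨ (x, f) = (6, 5) then 18 else
      if (x, f) = (5, 7) ∨ (x, f) = (7, 5) then 96 else if (x, f) = (6, 6) then 27 else 0) a b ≤ 96 := by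
  simp only [Prod.mk.injEq]
  split_ifs <;> omega

/-- the symmetry of the witness weights, as a finite computation -/
theorem cex_symm_bounded : ∀ a ∈ range 8, ∀ b ∈ range 8,
    ∑ u ∈ range 8, ∑ v ∈ range 8, (fun x f : ℕ => if (x, f) = (3, 6) ∨ (x, f) = (6, 3) then 60 else
      if (x, f) = (3, 7) ∨ (x, f) = (7, 3) then 40 else if (x, f) = (4, 4) then 75 else
      if (x, f) = (4, 6) ∨ (x, f) = (6, 4) then 25 else if (x, f) = (4, 7) ∨ (x, f) = (7, 4) then 60 else
      if (x, f) = (5, 5) then 60 else if (x, f) = (5, 6) ∨ (x, f) = (6, 5) then 18 else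
      if (x, f) = (5, 7) ∨ (x, f) = (7, 5) then 96 else if (x, f) = (6, 6) then 27 else 0) u v * (if u = a ∧ v = b then 1 else 0) =
    ∑ u ∈ range 8, ∑ v ∈ range 8, (fun x f : ℕ => if (x, f) = (3, 6) ∨ (x, f) = (6, 3) then 60 else
      if (x, f) = (3, 7) ∨ (x, f) = (7, 3) then 40 else if (x, f) = (4, 4) then 75 else
      if (x, f) = (4, 6) ∨ (x, f) = (6, 4) then 25 else if (x, f) = (4, 7) ∨ (x, f) = (7, 4) then 60 else
      if (x, f) = (5, 5) then 60 else if (x, f) = (5, 6) ∨ (x, f) = (6, 5) then 18 else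
      if (x, f) = (5, 7) ∨ (x, f) = (7, 5) then 96 else if (x, f) = (6, 6) then 27 else 0) u v * (if u = b ∧ v = a then 1 else 0) := by
  decide

/-- (PLD) FOR THE WITNESS AT THE CANONICAL BOUNDED PARAMETERS `lo ≤ hi ≤ 7`, `δ ≤ 7`, as a finite computation -/
theorem cex_pld_bounded : ∀ δ ∈ range 8, ∀ lo ∈ range 8, ∀ hi ∈ range 8, lo ≤ hi →
    ∑ u ∈ range 8, ∑ v ∈ range 8, (fun x f : ℕ => if (x, f) = (3, 6) ∨ (x, f) = (6, 3) then 60 else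
      if (x, f) = (3, 7) ∨ (x, f) = (7, 3) then 40 else if (x, f) = (4, 4) then 75 else
      if (x, f) = (4, 6) ∨ (x, f) = (6, 4) then 25 else if (x, f) = (4, 7) ∨ (x, f) = (7, 4) then 60 else
      if (x, f) = (5, 5) then 60 else if (x, f) = (5, 6) ∨ (x, f) = (6, 5) then 18 else
      if (x, f) = (5, 7) ∨ (x, f) = (7, 5) then 96 else if (x, f) = (6, 6) then 27 else 0) u v *
      (if lo ≤ u ∧ u ≤ hi ∧ (if lo = 0 then 0 else lo + hi + δ) ≤ v + u then v.choose δ else 0) ≤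
    ∑ u ∈ range 8, ∑ v ∈ range 8, (fun x f : ℕ => if (x, f) = (3, 6) ∨ (x, f) = (6, 3) then 60 else
      if (x, f) = (3, 7) ∨ (x, f) = (7, 3) then 40 else if (x, f) = (4, 4) then 75 else
      if (x, f) = (4, 6) ∨ (x, f) = (6, 4) then 25 else if (x, f) = (4, 7) ∨ (x, f) = (7, 4) then 60 else
      if (x, f) = (5, 5) then 60 else if (x, f) = (5, 6) ∨ (x, f) = (6, 5) then 18 else
      if (x, f) = (5, 7) ∨ (x, f) = (7, 5) then 96 else if (x, f) = (6, 6) then 27 else 0) u v *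
      (if lo + δ ≤ v ∧ v ≤ hi + δ then v.choose δ else 0) := by
  decide

/-- THE TRIANGLE CONVOLUTION OF THE WITNESS FAILS (PLD) AT `(5, 5, 1, 11)`, as a finite computation: `7858 > 7752` -/
theorem cex_triangle_bounded :
    ¬ (∑ u ∈ range 8, ∑ v ∈ range 8, (fun x f : ℕ => if (x, f) = (3, 6) ∨ (x, f) = (6, 3) then 60 else
      if (x, f) = (3, 7) ∨ (x, f) = (7, 3) then 40 else if (x, f) = (4, 4) then 75 else
      if (x, f) = (4, 6) ∨ (x, f) = (6, 4) then 25 else if (x, f) = (4, 7) ∨ (x, f) = (7, 4) then 60 else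
      if (x, f) = (5, 5) then 60 else if (x, f) = (5, 6) ∨ (x, f) = (6, 5) then 18 else
      if (x, f) = (5, 7) ∨ (x, f) = (7, 5) then 96 else if (x, f) = (6, 6) then 27 else 0) u v * ∑ m ∈ range 4, Nat.choose 3 m *
        (if 5 ≤ u + min m 2 ∧ u + min m 2 ≤ 5 ∧ 11 ≤ (v + min (3 - m) 2) + (u + min m 2) then
          (v + min (3 - m) 2).choose 1 else 0) ≤
      ∑ u ∈ range 8, ∑ v ∈ range 8, (fun x f : ℕ => if (x, f) = (3, 6) ∨ (x, f) = (6, 3) then 60 else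
      if (x, f) = (3, 7) ∨ (x, f) = (7, 3) then 40 else if (x, f) = (4, 4) then 75 else
      if (x, f) = (4, 6) ∨ (x, f) = (6, 4) then 25 else if (x, f) = (4, 7) ∨ (x, f) = (7, 4) then 60 else
      if (x, f) = (5, 5) then 60 else if (x, f) = (5, 6) ∨ (x, f) = (6, 5) then 18 else
      if (x, f) = (5, 7) ∨ (x, f) = (7, 5) then 96 else if (x, f) = (6, 6) then 27 else 0) u v * ∑ m ∈ range 4, Nat.choose 3 m *
        (if 5 + 1 ≤ v + min (3 - m) 2 ∧ v + min (3 - m) 2 ≤ 5 + 1 then (v + min (3 - m) 2).choose 1 else 0)) := by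
  decide

/-- THE SYMMETRY OF THE WITNESS FAMILY: every pair `(a, b)` occurs as often as `(b, a)`. -/
theorem cex_card_symm (a b : ℕ) :
    Finset.card ((((range 8 ×ˢ range 8) ×ˢ range 96).filter (fun p : (ℕ × ℕ) × ℕ => p.2 < (fun x f : ℕ => if (x, f) = (3, 6) ∨ (x, f) = (6, 3) then 60 else
      if (x, f) = (3, 7) ∨ (x, f) = (7, 3) then 40 else if (x, f) = (4, 4) then 75 else
      if (x, f) = (4, 6) ∨ (x, f) = (6, 4) then 25 else if (x, f) = (4, 7) ∨ (x, f) = (7, 4) then 60 else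
      if (x, f) = (5, 5) then 60 else if (x, f) = (5, 6) ∨ (x, f) = (6, 5) then 18 else
      if (x, f) = (5, 7) ∨ (x, f) = (7, 5) then 96 else if (x, f) = (6, 6) then 27 else 0) p.1.1 p.1.2)).filter (fun i => i.1.1 = a ∧ i.1.2 = b)) =
      Finset.card ((((range 8 ×ˢ range 8) ×ˢ range 96).filter (fun p : (ℕ × ℕ) × ℕ => p.2 < (fun x f : ℕ => if (x, f) = (3, 6) ∨ (x, f) = (6, 3) then 60 else
      if (x, f) = (3, 7) ∨ (x, f) = (7, 3) then 40 else if (x, f) = (4, 4) then 75 else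
      if (x, f) = (4, 6) ∨ (x, f) = (6, 4) then 25 else if (x, f) = (4, 7) ∨ (x, f) = (7, 4) then 60 else
      if (x, f) = (5, 5) then 60 else if (x, f) = (5, 6) ∨ (x, f) = (6, 5) then 18 else
      if (x, f) = (5, 7) ∨ (x, f) = (7, 5) then 96 else if (x, f) = (6, 6) then 27 else 0) p.1.1 p.1.2)).filter (fun i => i.1.1 = b ∧ i.1.2 = a)) := by
  have hw : ∀ a b, (fun x f : ℕ => if (x, f) = (3, 6) ∨ (x, f) = (6, 3) then 60 else
      if (x, f) = (3, 7) ∨ (x, f) = (7, 3) then 40 else if (x, f) = (4, 4) then 75 else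
      if (x, f) = (4, 6) ∨ (x, f) = (6, 4) then 25 else if (x, f) = (4, 7) ∨ (x, f) = (7, 4) then 60 else
      if (x, f) = (5, 5) then 60 else if (x, f) = (5, 6) ∨ (x, f) = (6, 5) then 18 else
      if (x, f) = (5, 7) ∨ (x, f) = (7, 5) then 96 else if (x, f) = (6, 6) then 27 else 0) a b ≤ 96 := cex_le
  have h1 := sum_weighted 8 96 _ hw (fun u v => if u = a ∧ v = b then 1 else 0)
  have h2 := sum_weighted 8 96 _ hw (fun u v => if u = b ∧ v = a then 1 else 0)
  beta_reduce at h1 h2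
  rw [Finset.card_filter, Finset.card_filter, h1, h2]
  rcases Nat.lt_or_ge a 8 with ha | ha <;> rcases Nat.lt_or_ge b 8 with hb | hb
  · exact cex_symm_bounded a (mem_range.2 ha) b (mem_range.2 hb)
  all_goals
    refine (Finset.sum_eq_zero fun u hu => Finset.sum_eq_zero fun v hv => ?_).trans
      (Finset.sum_eq_zero fun u hu => Finset.sum_eq_zero fun v hv => ?_).symm
    all_goals
      rw [mem_range] at hu hv
      dsimp only
      first
        | rw [if_neg (by omega : ¬ (u = a ∧ v = b)), mul_zero]
        | rw [if_neg (by omega : ¬ (u = b ∧ v = a)), mul_zero]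

set_option maxRecDepth 4000 in
/-- THE WITNESS SATISFIES (PLD) AT EVERY ADMISSIBLE PARAMETER. -/
theorem cex_pld :
    ∀ lo hi δ Θ : ℕ, Θ ≤ lo + hi + δ → (lo = 0 ∨ lo + hi + δ ≤ Θ) →
      ∑ i ∈ (((range 8 ×ˢ range 8) ×ˢ range 96).filter (fun p : (ℕ × ℕ) × ℕ => p.2 < (fun x f : ℕ => if (x, f) = (3, 6) ∨ (x, f) = (6, 3) then 60 else
      if (x, f) = (3, 7) ∨ (x, f) = (7, 3) then 40 else if (x, f) = (4, 4) then 75 else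
      if (x, f) = (4, 6) ∨ (x, f) = (6, 4) then 25 else if (x, f) = (4, 7) ∨ (x, f) = (7, 4) then 60 else
      if (x, f) = (5, 5) then 60 else if (x, f) = (5, 6) ∨ (x, f) = (6, 5) then 18 else
      if (x, f) = (5, 7) ∨ (x, f) = (7, 5) then 96 else if (x, f) = (6, 6) then 27 else 0) p.1.1 p.1.2)),
          (if lo ≤ i.1.1 ∧ i.1.1 ≤ hi ∧ Θ ≤ i.1.2 + i.1.1 then (i.1.2).choose δ else 0) ≤
        ∑ i ∈ (((range 8 ×ˢ range 8) ×ˢ range 96).filter (fun p : (ℕ × ℕ) × ℕ => p.2 < (fun x f : ℕ => if (x, f) = (3, 6) ∨ (x, f) = (6, 3) then 60 else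
      if (x, f) = (3, 7) ∨ (x, f) = (7, 3) then 40 else if (x, f) = (4, 4) then 75 else
      if (x, f) = (4, 6) ∨ (x, f) = (6, 4) then 25 else if (x, f) = (4, 7) ∨ (x, f) = (7, 4) then 60 else
      if (x, f) = (5, 5) then 60 else if (x, f) = (5, 6) ∨ (x, f) = (6, 5) then 18 else
      if (x, f) = (5, 7) ∨ (x, f) = (7, 5) then 96 else if (x, f) = (6, 6) then 27 else 0) p.1.1 p.1.2)),
          (if lo + δ ≤ i.1.2 ∧ i.1.2 ≤ hi + δ then (i.1.2).choose δ else 0) := by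
  have hw : ∀ a b, (fun x f : ℕ => if (x, f) = (3, 6) ∨ (x, f) = (6, 3) then 60 else
      if (x, f) = (3, 7) ∨ (x, f) = (7, 3) then 40 else if (x, f) = (4, 4) then 75 else
      if (x, f) = (4, 6) ∨ (x, f) = (6, 4) then 25 else if (x, f) = (4, 7) ∨ (x, f) = (7, 4) then 60 else
      if (x, f) = (5, 5) then 60 else if (x, f) = (5, 6) ∨ (x, f) = (6, 5) then 18 else
      if (x, f) = (5, 7) ∨ (x, f) = (7, 5) then 96 else if (x, f) = (6, 6) then 27 else 0) a b ≤ 96 := cex_le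
  have hb : ∀ i ∈ (((range 8 ×ˢ range 8) ×ˢ range 96).filter (fun p : (ℕ × ℕ) × ℕ => p.2 < (fun x f : ℕ => if (x, f) = (3, 6) ∨ (x, f) = (6, 3) then 60 else
      if (x, f) = (3, 7) ∨ (x, f) = (7, 3) then 40 else if (x, f) = (4, 4) then 75 else
      if (x, f) = (4, 6) ∨ (x, f) = (6, 4) then 25 else if (x, f) = (4, 7) ∨ (x, f) = (7, 4) then 60 else
      if (x, f) = (5, 5) then 60 else if (x, f) = (5, 6) ∨ (x, f) = (6, 5) then 18 else
      if (x, f) = (5, 7) ∨ (x, f) = (7, 5) then 96 else if (x, f) = (6, 6) then 27 else 0) p.1.1 p.1.2)), i.1.1 ≤ 7 ∧ i.1.2 ≤ 7 := by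
    intro i hi
    simp only [mem_filter, mem_product, mem_range] at hi
    omega
  have hcan : ∀ lo hi δ : ℕ, lo ≤ hi → hi ≤ 7 → δ ≤ 7 →
      ∑ i ∈ (((range 8 ×ˢ range 8) ×ˢ range 96).filter (fun p : (ℕ × ℕ) × ℕ => p.2 < (fun x f : ℕ => if (x, f) = (3, 6) ∨ (x, f) = (6, 3) then 60 else
      if (x, f) = (3, 7) ∨ (x, f) = (7, 3) then 40 else if (x, f) = (4, 4) then 75 else
      if (x, f) = (4, 6) ∨ (x, f) = (6, 4) then 25 else if (x, f) = (4, 7) ∨ (x, f) = (7, 4) then 60 else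
      if (x, f) = (5, 5) then 60 else if (x, f) = (5, 6) ∨ (x, f) = (6, 5) then 18 else
      if (x, f) = (5, 7) ∨ (x, f) = (7, 5) then 96 else if (x, f) = (6, 6) then 27 else 0) p.1.1 p.1.2)),
          (if lo ≤ i.1.1 ∧ i.1.1 ≤ hi ∧ (if lo = 0 then 0 else lo + hi + δ) ≤ i.1.2 + i.1.1 then
            (i.1.2).choose δ else 0) ≤
        ∑ i ∈ (((range 8 ×ˢ range 8) ×ˢ range 96).filter (fun p : (ℕ × ℕ) × ℕ => p.2 < (fun x f : ℕ => if (x, f) = (3, 6) ∨ (x, f) = (6, 3) then 60 else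
      if (x, f) = (3, 7) ∨ (x, f) = (7, 3) then 40 else if (x, f) = (4, 4) then 75 else
      if (x, f) = (4, 6) ∨ (x, f) = (6, 4) then 25 else if (x, f) = (4, 7) ∨ (x, f) = (7, 4) then 60 else
      if (x, f) = (5, 5) then 60 else if (x, f) = (5, 6) ∨ (x, f) = (6, 5) then 18 else
      if (x, f) = (5, 7) ∨ (x, f) = (7, 5) then 96 else if (x, f) = (6, 6) then 27 else 0) p.1.1 p.1.2)),
          (if lo + δ ≤ i.1.2 ∧ i.1.2 ≤ hi + δ then (i.1.2).choose δ else 0) := by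
    intro lo hi δ hlh hhR hδR
    have h1 := sum_weighted 8 96 _ hw (fun u v =>
        if lo ≤ u ∧ u ≤ hi ∧ (if lo = 0 then 0 else lo + hi + δ) ≤ v + u then v.choose δ else 0)
    have h2 := sum_weighted 8 96 _ hw (fun u v => if lo + δ ≤ v ∧ v ≤ hi + δ then v.choose δ else 0)
    beta_reduce at h1 h2
    rw [h1, h2]
    exact cex_pld_bounded δ (mem_range.2 (by omega)) lo (mem_range.2 (by omega)) hi (mem_range.2 (by omega)) hlh
  have H := pld_of_bounded (((range 8 ×ˢ range 8) ×ˢ range 96).filter (fun p : (ℕ × ℕ) × ℕ => p.2 < (fun x f : ℕ => if (x, f) = (3, 6) ∨ (x, f) = (6, 3) then 60 else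
      if (x, f) = (3, 7) ∨ (x, f) = (7, 3) then 40 else if (x, f) = (4, 4) then 75 else
      if (x, f) = (4, 6) ∨ (x, f) = (6, 4) then 25 else if (x, f) = (4, 7) ∨ (x, f) = (7, 4) then 60 else
      if (x, f) = (5, 5) then 60 else if (x, f) = (5, 6) ∨ (x, f) = (6, 5) then 18 else
      if (x, f) = (5, 7) ∨ (x, f) = (7, 5) then 96 else if (x, f) = (6, 6) then 27 else 0) p.1.1 p.1.2)) (fun i => i.1.1) (fun i => i.1.2) 7 hb hcan
  beta_reduce at H
  exact H

/-- THE CONVOLUTION OF THE WITNESS WITH THE TRIANGLE FAILS (PLD) AT `(5, 5, 1, 11)`: `7858 > 7752`. -/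
theorem cex_triangle_fails :
    ¬ (∑ j ∈ (((range 8 ×ˢ range 8) ×ˢ range 96).filter (fun p : (ℕ × ℕ) × ℕ => p.2 < (fun x f : ℕ => if (x, f) = (3, 6) ∨ (x, f) = (6, 3) then 60 else
      if (x, f) = (3, 7) ∨ (x, f) = (7, 3) then 40 else if (x, f) = (4, 4) then 75 else
      if (x, f) = (4, 6) ∨ (x, f) = (6, 4) then 25 else if (x, f) = (4, 7) ∨ (x, f) = (7, 4) then 60 else
      if (x, f) = (5, 5) then 60 else if (x, f) = (5, 6) ∨ (x, f) = (6, 5) then 18 else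
      if (x, f) = (5, 7) ∨ (x, f) = (7, 5) then 96 else if (x, f) = (6, 6) then 27 else 0) p.1.1 p.1.2)) ×ˢ (univ : Finset (Finset (Fin 3))),
          (if 5 ≤ j.1.1.1 + min (Finset.card j.2) 2 ∧ j.1.1.1 + min (Finset.card j.2) 2 ≤ 5 ∧
              11 ≤ (j.1.1.2 + min (3 - Finset.card j.2) 2) + (j.1.1.1 + min (Finset.card j.2) 2) then
            (j.1.1.2 + min (3 - Finset.card j.2) 2).choose 1 else 0) ≤
        ∑ j ∈ (((range 8 ×ˢ range 8) ×ˢ range 96).filter (fun p : (ℕ × ℕ) × ℕ => p.2 < (fun x f : ℕ => if (x, f) = (3, 6) ∨ (x, f) = (6, 3) then 60 else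
      if (x, f) = (3, 7) ∨ (x, f) = (7, 3) then 40 else if (x, f) = (4, 4) then 75 else
      if (x, f) = (4, 6) ∨ (x, f) = (6, 4) then 25 else if (x, f) = (4, 7) ∨ (x, f) = (7, 4) then 60 else
      if (x, f) = (5, 5) then 60 else if (x, f) = (5, 6) ∨ (x, f) = (6, 5) then 18 else
      if (x, f) = (5, 7) ∨ (x, f) = (7, 5) then 96 else if (x, f) = (6, 6) then 27 else 0) p.1.1 p.1.2)) ×ˢ (univ : Finset (Finset (Fin 3))),
          (if 5 + 1 ≤ j.1.1.2 + min (3 - Finset.card j.2) 2 ∧ j.1.1.2 + min (3 - Finset.card j.2) 2 ≤ 5 + 1 then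
            (j.1.1.2 + min (3 - Finset.card j.2) 2).choose 1 else 0)) := by
  have hw : ∀ a b, (fun x f : ℕ => if (x, f) = (3, 6) ∨ (x, f) = (6, 3) then 60 else
      if (x, f) = (3, 7) ∨ (x, f) = (7, 3) then 40 else if (x, f) = (4, 4) then 75 else
      if (x, f) = (4, 6) ∨ (x, f) = (6, 4) then 25 else if (x, f) = (4, 7) ∨ (x, f) = (7, 4) then 60 else
      if (x, f) = (5, 5) then 60 else if (x, f) = (5, 6) ∨ (x, f) = (6, 5) then 18 else
      if (x, f) = (5, 7) ∨ (x, f) = (7, 5) then 96 else if (x, f) = (6, 6) then 27 else 0) a b ≤ 96 := cex_le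
  have h1 := sum_triangle (((range 8 ×ˢ range 8) ×ˢ range 96).filter (fun p : (ℕ × ℕ) × ℕ => p.2 < (fun x f : ℕ => if (x, f) = (3, 6) ∨ (x, f) = (6, 3) then 60 else
      if (x, f) = (3, 7) ∨ (x, f) = (7, 3) then 40 else if (x, f) = (4, 4) then 75 else
      if (x, f) = (4, 6) ∨ (x, f) = (6, 4) then 25 else if (x, f) = (4, 7) ∨ (x, f) = (7, 4) then 60 else
      if (x, f) = (5, 5) then 60 else if (x, f) = (5, 6) ∨ (x, f) = (6, 5) then 18 else
      if (x, f) = (5, 7) ∨ (x, f) = (7, 5) then 96 else if (x, f) = (6, 6) then 27 else 0) p.1.1 p.1.2)) (fun i => i.1.1) (fun i => i.1.2)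
      (fun u v => if 5 ≤ u ∧ u ≤ 5 ∧ 11 ≤ v + u then v.choose 1 else 0)
  have h2 := sum_triangle (((range 8 ×ˢ range 8) ×ˢ range 96).filter (fun p : (ℕ × ℕ) × ℕ => p.2 < (fun x f : ℕ => if (x, f) = (3, 6) ∨ (x, f) = (6, 3) then 60 else
      if (x, f) = (3, 7) ∨ (x, f) = (7, 3) then 40 else if (x, f) = (4, 4) then 75 else
      if (x, f) = (4, 6) ∨ (x, f) = (6, 4) then 25 else if (x, f) = (4, 7) ∨ (x, f) = (7, 4) then 60 else
      if (x, f) = (5, 5) then 60 else if (x, f) = (5, 6) ∨ (x, f) = (6, 5) then 18 else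
      if (x, f) = (5, 7) ∨ (x, f) = (7, 5) then 96 else if (x, f) = (6, 6) then 27 else 0) p.1.1 p.1.2)) (fun i => i.1.1) (fun i => i.1.2)
      (fun u v => if 5 + 1 ≤ v ∧ v ≤ 5 + 1 then v.choose 1 else 0)
  have h3 := sum_weighted 8 96 _ hw (fun u v => ∑ m ∈ range 4, Nat.choose 3 m *
        (if 5 ≤ u + min m 2 ∧ u + min m 2 ≤ 5 ∧ 11 ≤ (v + min (3 - m) 2) + (u + min m 2) then
          (v + min (3 - m) 2).choose 1 else 0))
  have h4 := sum_weighted 8 96 _ hw (fun u v => ∑ m ∈ range 4, Nat.choose 3 m *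
        (if 5 + 1 ≤ v + min (3 - m) 2 ∧ v + min (3 - m) 2 ≤ 5 + 1 then (v + min (3 - m) 2).choose 1 else 0))
  beta_reduce at h1 h2 h3 h4
  rw [h1, h2, h3, h4]
  exact cex_triangle_bounded

/-- THE REFUTATION: there is a finite family of pairs `(x, f)`, SYMMETRIC under `(x, f) ↦ (f, x)` (as every matroid
profile is) and satisfying PER-LAYER DOMINANCE at every admissible parameter, whose convolution with the triangle
`U_{2,3}` — the profile of `M ⊕ U_{2,3}` when the family is the profile of `M` — violates (PLD).  So
`(PLD)(M) ⇒ (PLD)(M ⊕ U_{2,3})` has no proof through the symmetric rank profile of `M` alone. -/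
theorem pld_symm_not_closed_triangle :
    ∃ (s : Finset ((ℕ × ℕ) × ℕ)) (x f : (ℕ × ℕ) × ℕ → ℕ),
      (∀ a b : ℕ, (s.filter (fun i => x i = a ∧ f i = b)).card = (s.filter (fun i => x i = b ∧ f i = a)).card) ∧
      (∀ lo hi δ Θ : ℕ, Θ ≤ lo + hi + δ → (lo = 0 ∨ lo + hi + δ ≤ Θ) →
        ∑ i ∈ s, (if lo ≤ x i ∧ x i ≤ hi ∧ Θ ≤ f i + x i then (f i).choose δ else 0) ≤
          ∑ i ∈ s, (if lo + δ ≤ f i ∧ f i ≤ hi + δ then (f i).choose δ else 0)) ∧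
      ¬ (∀ lo hi δ Θ : ℕ, Θ ≤ lo + hi + δ → (lo = 0 ∨ lo + hi + δ ≤ Θ) →
        ∑ j ∈ s ×ˢ (univ : Finset (Finset (Fin 3))),
            (if lo ≤ x j.1 + min (Finset.card j.2) 2 ∧ x j.1 + min (Finset.card j.2) 2 ≤ hi ∧
                Θ ≤ (f j.1 + min (3 - Finset.card j.2) 2) + (x j.1 + min (Finset.card j.2) 2) then
              (f j.1 + min (3 - Finset.card j.2) 2).choose δ else 0) ≤
          ∑ j ∈ s ×ˢ (univ : Finset (Finset (Fin 3))),
            (if lo + δ ≤ f j.1 + min (3 - Finset.card j.2) 2 ∧ f j.1 + min (3 - Finset.card j.2) 2 ≤ hi + δ then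
              (f j.1 + min (3 - Finset.card j.2) 2).choose δ else 0)) := by
  refine ⟨_, fun i => i.1.1, fun i => i.1.2, cex_card_symm, cex_pld, fun hcl => ?_⟩
  exact cex_triangle_fails (hcl 5 5 1 11 (by norm_num) (Or.inr (by norm_num)))

end PLDSymCex

end PercRepro
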